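import Mathlib
import Literature.NumberTheory.LFunctions.Zhang2022.Section13U007bTools
import HarnessLib

/-!
# Zhang (2022) §13 (13.11): the `E₁`-reduction (item I3-E of WP14-PLAN §3) — Cauchy–Schwarz in `v`
# AGAINST the Gaussian weight, kernel-checked

Topic `Literature/NumberTheory/LFunctions/Zhang2022` (Landau–Siegel audit tree; verdict-neutral).
Y. Zhang, *Discrete mean estimates and the Landau–Siegel zero*, arXiv:2211.02515v1 (2022)
[Zhang2022LandauSiegel], §13 p. 75, (13.11) (tex L3806–L3817: "Combining (2.34), Cauchy's inequality,
Proposition 7.1, Lemma 5.9, 6.1 and 3.3, we can verify that `𝓔 = o(𝔓)`" — not carried out in print,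
GAP-LEDGER G-L3t6-3) — **an unrefereed manuscript under adjudication**. Lane ZHANG-L (WP14 §3,
leaf h1311 `Skeleton.Eq1311Rel c′ c137`; statements fixed in zl-w14-typer's scratch
`Section13Signatures.lean`, item I3-E).

`𝓔` carries Lemma 6.1's error `E₁(w,ψ) = 𝓛⁻⁶⁸∫_{−𝓛²⁰}^{𝓛²⁰}|D_{T³}(w+iv,ψ)|e^{−v²/(4𝓛³⁰)}dv`
(`Skeleton.E1main`, `D_{T³}(w,ψ) = Σ_{n<T³}ψ(n)n^{−w}`) multiplied by the Dirichlet polynomials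
`B_i(s,ψ)`. The tree's `Typed.Section13.sum_E1main_sq_le` (Section13U007bTools) bounds `Σ_ψE₁²` by
Cauchy–Schwarz with the Gaussian weight REPLACED BY `1` — losing the interval length `2𝓛²⁰` against
the Gaussian mass `2√π𝓛¹⁵`, which the (13.11) budget (WP14-PLAN risk R-1) cannot afford. This
theorem-only file (0 definitions, 0 named facts) proves the SHARP reduction:

* `sq_integral_mul_le` — the weighted Cauchy–Schwarz inequality
  `(∫_a^b f·w)² ≤ (∫_a^b w)·(∫_a^b f²·w)` for continuous real `f`, `w ≥ 0` (discriminant of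
  `t ↦ ∫_a^b (t − f)²w ≥ 0`);
* `integral_gaussWeight_le` — `∫_{−L}^{L} e^{−v²/(4𝓛³⁰)}dv ≤ 2√π𝓛¹⁵` (`≤` the full Gaussian integral,
  Mathlib `integral_gaussian`);
* **`sum_E1main_sq_mul_le`** — the typer's I3-E reduction VERBATIM: for any finite family `T` of
  characters, any point `w`, any non-negative `ψ`-weight `g` and `𝓛 ≥ 3`,
  `Σ_{ψ∈T} E₁(w,ψ)²·g(ψ) ≤ 𝓛⁻¹³⁶·(2√π𝓛¹⁵)·∫_{−𝓛²⁰}^{𝓛²⁰}(Σ_{ψ∈T}|D_{T³}(w+iv,ψ)|²·g(ψ))e^{−v²/(4𝓛³⁰)}dv`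
  (Fubini for the finite sum; the Gaussian is KEPT, `ω₁ ≤ 1` is not used);
* **`meanSq_E1main_mul_B1_le_of`, `meanSq_E1main_mul_B2_le_of`** — the edges I3-D₁ → I3-E₁ and
  I3-D₂ → I3-E₂ of the scratch, for EVERY exponent `kD : ℕ`: a two-point mean-value bound
  `Σ_{ψ∈T}|D_{T³}(w,ψ)B_i(s,ψ)|² ≤ C·P²·𝓛^{kD}` on the strip `|Re s − ½|, |Re w − ½| ≤ 2α` (item I3-D,
  stated inline as the hypothesis, verbatim the scratch) yields
  `Σ_{ψ∈T} E₁(w,ψ)²|B_i(s,ψ)|² ≤ 4πC·P²·𝓛^{kD+30}/𝓛¹³⁶` on the same strip (the points `w + iv` stay in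
  the strip since `Re(w+iv) = Re w`).

WHAT THIS IS NOT: a proof of I3-D (the two-point large-sieve bound, owner zl-w14-p5), of (13.11), or of
anything about Theorems 1–2 of the manuscript / Landau–Siegel zeros.

## References

* Y. Zhang, arXiv:2211.02515v1 (2022), §13 (13.11) p. 75; §6 Lemma 6.1 p. 31 (definition of `E₁`).
  [cite: Zhang2022LandauSiegel, §13 (13.11) p.75]
-/

noncomputable section

open Complex Real MeasureTheory

namespace Literature.NumberTheory.LFunctions.Zhang2022.Typed.Section13

open Skeleton

/-! ## Weighted Cauchy–Schwarz for interval integrals -/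

/-- **`(∫_a^b f·w)² ≤ (∫_a^b w)·(∫_a^b f²·w)`** for continuous real `f, w` with `w ≥ 0` and `a ≤ b`
(the quadratic `t ↦ ∫_a^b (t − f)²w = (∫w)t² − 2(∫fw)t + ∫f²w` is non-negative, so its discriminant is
`≤ 0`) — the "Cauchy's inequality" of the (13.11) sentence, in the weighted form the `E₁`-term needs.
[cite: Zhang2022LandauSiegel, §13 (13.11) p.75] -/
theorem sq_integral_mul_le {f w : ℝ → ℝ} (hf : Continuous f) (hw : Continuous w)
    (hw0 : ∀ v, 0 ≤ w v) {a b : ℝ} (hab : a ≤ b) :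
    (∫ v in a..b, f v * w v) ^ 2 ≤ (∫ v in a..b, w v) * ∫ v in a..b, f v ^ 2 * w v := by
  set W : ℝ := ∫ v in a..b, w v with hW
  set J : ℝ := ∫ v in a..b, f v * w v with hJ
  set K : ℝ := ∫ v in a..b, f v ^ 2 * w v with hK
  have hiw : IntervalIntegrable w volume a b := hw.intervalIntegrable _ _
  have hifw : IntervalIntegrable (fun v => f v * w v) volume a b := (hf.mul hw).intervalIntegrable _ _
  have hif2w : IntervalIntegrable (fun v => f v ^ 2 * w v) volume a b :=
    ((hf.pow 2).mul hw).intervalIntegrable _ _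
  -- the quadratic in `t`
  have hquad : ∀ t : ℝ, 0 ≤ W * (t * t) + (-2 * J) * t + K := by
    intro t
    have hnn : 0 ≤ ∫ v in a..b, (t - f v) ^ 2 * w v :=
      intervalIntegral.integral_nonneg hab fun v _ => mul_nonneg (sq_nonneg _) (hw0 v)
    have hexp : ∫ v in a..b, (t - f v) ^ 2 * w v = W * (t * t) + (-2 * J) * t + K := by
      have hfun : (fun v => (t - f v) ^ 2 * w v) =
          fun v => t ^ 2 * w v - (2 * t) * (f v * w v) + f v ^ 2 * w v := by
        funext v; ring
      rw [hfun, intervalIntegral.integral_add ((hiw.const_mul _).sub (hifw.const_mul _)) hif2w,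
        intervalIntegral.integral_sub (hiw.const_mul _) (hifw.const_mul _),
        intervalIntegral.integral_const_mul, intervalIntegral.integral_const_mul]
      rw [hW, hJ, hK]
      ring
    rw [← hexp]
    exact hnn
  have hdisc := discrim_le_zero hquad
  rw [discrim] at hdisc
  nlinarith [hdisc]

/-! ## The Gaussian mass `∫_{−L}^{L} e^{−v²/(4𝓛³⁰)}dv ≤ 2√π𝓛¹⁵` -/

/-- **`∫_{−L}^{L} e^{−v²/(4𝓛³⁰)}dv ≤ 2√π·𝓛¹⁵`** for `𝓛 > 0`, `L ≥ 0` (the segment integral of the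
Gaussian weight of Lemma 6.1's `E₁(s,ψ)` is at most the full one, `√(4π𝓛³⁰)`).
[cite: Zhang2022LandauSiegel, §6 Lemma 6.1 p.31] -/
theorem integral_gaussWeight_le {ℓ L : ℝ} (hℓ : 0 < ℓ) (hL : 0 ≤ L) :
    ∫ v in (-L)..L, Real.exp (-(v ^ 2) / (4 * ℓ ^ 30)) ≤ 2 * Real.sqrt π * ℓ ^ 15 := by
  have hb : 0 < 1 / (4 * ℓ ^ 30) := by positivity
  set g : ℝ → ℝ := fun v => Real.exp (-(1 / (4 * ℓ ^ 30)) * v ^ 2) with hg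
  have hgi : Integrable g := integrable_exp_neg_mul_sq hb
  have hpt : (fun v : ℝ => Real.exp (-(v ^ 2) / (4 * ℓ ^ 30))) = g := by
    funext v; rw [hg]; congr 1; ring
  rw [hpt]
  have hle : ∫ v in (-L)..L, g v ≤ ∫ v, g v := by
    rw [intervalIntegral.integral_of_le (by linarith)]
    exact setIntegral_le_integral hgi (Filter.Eventually.of_forall fun v => (Real.exp_pos _).le)
  have hfull : ∫ v, g v = 2 * Real.sqrt π * ℓ ^ 15 := by
    rw [hg, integral_gaussian,
      show π / (1 / (4 * ℓ ^ 30)) = (2 * ℓ ^ 15) ^ 2 * π by field_simp; ring,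
      Real.sqrt_mul (by positivity) π, Real.sqrt_sq (by positivity)]
    ring
  exact hle.trans_eq hfull

/-! ## I3-E: the `E₁`-reduction with the Gaussian kept -/

/-- **I3-E, generic weight form (WP14-PLAN §3; zl-w14-typer's `sum_E1main_sq_mul_le` verbatim)**: for
`𝓛 ≥ 3`, any finite family `T`, any `w` and any non-negative weight `g` on characters,
`Σ_{ψ∈T} E₁(w,ψ)²·g(ψ) ≤ 𝓛⁻¹³⁶·(2√π𝓛¹⁵)·∫_{−𝓛²⁰}^{𝓛²⁰}(Σ_{ψ∈T}|D_{T³}(w+iv,ψ)|²·g(ψ))e^{−v²/(4𝓛³⁰)}dv`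
— Cauchy–Schwarz in `v` against the Gaussian (`(∫Fω₁)² ≤ (∫ω₁)(∫F²ω₁)`, `∫ω₁ ≤ 2√π𝓛¹⁵`) and Fubini
for the finite `ψ`-sum; `ω₁ ≤ 1` is NOT used (R-1 (1)). [cite: Zhang2022LandauSiegel, §13 (13.11) p.75; §6 Lemma 6.1] -/
theorem sum_E1main_sq_mul_le {D : ℕ} (T : Finset (Chr D)) (hL : 3 ≤ ell D) (w : ℂ)
    (g : Chr D → ℝ) (hg : ∀ x, 0 ≤ g x) :
    ∑ x ∈ T, E1main x w ^ 2 * g x ≤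
      (ell D ^ 68)⁻¹ ^ 2 * (2 * Real.sqrt π * ell D ^ 15) *
        ∫ v in (-(ell D ^ 20))..(ell D ^ 20),
          (∑ x ∈ T, ‖∑ n ∈ Finset.Ico 1 ⌈bigT D ^ 3⌉₊,
              x.ψ (n : ZMod x.p) * (n : ℂ) ^ (-(w + v * I))‖ ^ 2 * g x) *
            Real.exp (-(v ^ 2) / (4 * ell D ^ 30)) := by
  have hL0 : 0 < ell D := by linarith
  set Lw : ℝ := ell D ^ 20 with hLw
  have hLw0 : 0 ≤ Lw := by positivity
  -- the polynomial and the weight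
  set F : Chr D → ℝ → ℝ := fun x v =>
    ‖∑ n ∈ Finset.Ico 1 ⌈bigT D ^ 3⌉₊, x.ψ (n : ZMod x.p) * (n : ℂ) ^ (-(w + v * I))‖ with hF
  set wt : ℝ → ℝ := fun v => Real.exp (-(v ^ 2) / (4 * ell D ^ 30)) with hwt
  have hFc : ∀ x, Continuous (F x) := fun x => continuous_norm_dirPoly_shift x w _
  have hwtc : Continuous wt := by
    rw [hwt]; exact Real.continuous_exp.comp (by fun_prop)
  have hwt0 : ∀ v, 0 ≤ wt v := fun v => (Real.exp_pos _).le
  set G : ℝ := ∫ v in (-Lw)..Lw, wt v with hGdef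
  have hG0 : 0 ≤ G := intervalIntegral.integral_nonneg (by linarith) fun v _ => hwt0 v
  have hGle : G ≤ 2 * Real.sqrt π * ell D ^ 15 := integral_gaussWeight_le hL0 hLw0
  -- (1) weighted Cauchy–Schwarz for each `ψ`
  have hE : ∀ x, E1main x w ^ 2 ≤ (ell D ^ 68)⁻¹ ^ 2 * (G * ∫ v in (-Lw)..Lw, F x v ^ 2 * wt v) := by
    intro x
    have hdef : E1main x w = (ell D ^ 68)⁻¹ * ∫ v in (-Lw)..Lw, F x v * wt v := rfl
    rw [hdef, mul_pow]
    exact mul_le_mul_of_nonneg_left (sq_integral_mul_le (hFc x) hwtc hwt0 (by linarith)) (sq_nonneg _)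
  -- (2) sum over `ψ` and interchange
  have hint : ∀ x ∈ T, IntervalIntegrable (fun v => F x v ^ 2 * wt v * g x) volume (-Lw) Lw :=
    fun x _ => ((((hFc x).pow 2).mul hwtc).mul continuous_const).intervalIntegrable _ _
  have hswap : ∑ x ∈ T, (∫ v in (-Lw)..Lw, F x v ^ 2 * wt v) * g x =
      ∫ v in (-Lw)..Lw, (∑ x ∈ T, F x v ^ 2 * g x) * wt v := by
    have h1 : ∀ x ∈ T, (∫ v in (-Lw)..Lw, F x v ^ 2 * wt v) * g x =
        ∫ v in (-Lw)..Lw, F x v ^ 2 * wt v * g x := by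
      intro x _
      rw [← intervalIntegral.integral_mul_const]
    rw [Finset.sum_congr rfl h1, ← intervalIntegral.integral_finsetSum hint]
    refine intervalIntegral.integral_congr fun v _ => ?_
    simp only [Finset.sum_mul]
    refine Finset.sum_congr rfl fun x _ => ?_
    ring
  calc ∑ x ∈ T, E1main x w ^ 2 * g x
      ≤ ∑ x ∈ T, (ell D ^ 68)⁻¹ ^ 2 * (G * ∫ v in (-Lw)..Lw, F x v ^ 2 * wt v) * g x :=
        Finset.sum_le_sum fun x hx => mul_le_mul_of_nonneg_right (hE x) (hg x)
    _ = (ell D ^ 68)⁻¹ ^ 2 * G * ∑ x ∈ T, (∫ v in (-Lw)..Lw, F x v ^ 2 * wt v) * g x := by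
        rw [Finset.mul_sum]; refine Finset.sum_congr rfl fun x _ => ?_; ring
    _ = (ell D ^ 68)⁻¹ ^ 2 * G * ∫ v in (-Lw)..Lw, (∑ x ∈ T, F x v ^ 2 * g x) * wt v := by
        rw [hswap]
    _ ≤ (ell D ^ 68)⁻¹ ^ 2 * (2 * Real.sqrt π * ell D ^ 15) *
          ∫ v in (-Lw)..Lw, (∑ x ∈ T, F x v ^ 2 * g x) * wt v := by
        refine mul_le_mul_of_nonneg_right (mul_le_mul_of_nonneg_left hGle (sq_nonneg _)) ?_
        exact intervalIntegral.integral_nonneg (by linarith) fun v _ =>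
          mul_nonneg (Finset.sum_nonneg fun x _ => mul_nonneg (sq_nonneg _) (hg x)) (hwt0 v)

/-! ## The reduction against an arbitrary pointwise bound (shape-agnostic form) -/

/-- **I3-E against ANY uniform-in-`v` bound** (the form every instance uses, whatever the shape of the
two-point mean value — large sieve `C·P²·𝓛ᵏ` or Lemma 3.3 (i) `𝔓·Σ|c|²n^{−2σ}`): if `𝓛 ≥ 3` and
`Σ_{ψ∈T}|D_{T³}(w+iv,ψ)|²·g(ψ) ≤ M` for every real `v` (with `g ≥ 0`), then
`Σ_{ψ∈T} E₁(w,ψ)²·g(ψ) ≤ 4π·M·𝓛³⁰/𝓛¹³⁶` (`sum_E1main_sq_mul_le`, the bound integrated against the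
Gaussian, `∫ω₁ ≤ 2√π𝓛¹⁵` twice). [cite: Zhang2022LandauSiegel, §13 (13.11) p.75; §6 Lemma 6.1] -/
theorem sum_E1main_sq_mul_le_of_pointwise {D : ℕ} (T : Finset (Chr D)) (hL : 3 ≤ ell D) (w : ℂ)
    (g : Chr D → ℝ) (hg : ∀ x, 0 ≤ g x) {M : ℝ}
    (hM : ∀ v : ℝ, ∑ x ∈ T, ‖∑ n ∈ Finset.Ico 1 ⌈bigT D ^ 3⌉₊,
        x.ψ (n : ZMod x.p) * (n : ℂ) ^ (-(w + v * I))‖ ^ 2 * g x ≤ M) :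
    ∑ x ∈ T, E1main x w ^ 2 * g x ≤ 4 * π * M * ell D ^ 30 / ell D ^ 136 := by
  have hL0 : 0 < ell D := by linarith
  set Lw : ℝ := ell D ^ 20 with hLw
  set wt : ℝ → ℝ := fun v => Real.exp (-(v ^ 2) / (4 * ell D ^ 30)) with hwt
  have hM0 : 0 ≤ M := le_trans (Finset.sum_nonneg fun x _ => mul_nonneg (sq_nonneg _) (hg x)) (hM 0)
  have hred := sum_E1main_sq_mul_le T hL w g hg
  have hwtc : Continuous wt := by
    rw [hwt]; exact Real.continuous_exp.comp (by fun_prop)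
  have hwt0 : ∀ v, 0 ≤ wt v := fun v => (Real.exp_pos _).le
  have hcont : Continuous fun v : ℝ => ∑ x ∈ T, ‖∑ n ∈ Finset.Ico 1 ⌈bigT D ^ 3⌉₊,
      x.ψ (n : ZMod x.p) * (n : ℂ) ^ (-(w + v * I))‖ ^ 2 * g x :=
    continuous_finsetSum _ fun x _ => ((continuous_norm_dirPoly_shift x w _).pow 2).mul continuous_const
  have hint : ∫ v in (-Lw)..Lw, (∑ x ∈ T, ‖∑ n ∈ Finset.Ico 1 ⌈bigT D ^ 3⌉₊,
      x.ψ (n : ZMod x.p) * (n : ℂ) ^ (-(w + v * I))‖ ^ 2 * g x) * wt v ≤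
      M * (2 * Real.sqrt π * ell D ^ 15) := by
    calc ∫ v in (-Lw)..Lw, (∑ x ∈ T, ‖∑ n ∈ Finset.Ico 1 ⌈bigT D ^ 3⌉₊,
          x.ψ (n : ZMod x.p) * (n : ℂ) ^ (-(w + v * I))‖ ^ 2 * g x) * wt v
        ≤ ∫ v in (-Lw)..Lw, M * wt v := by
          refine intervalIntegral.integral_mono_on (by rw [hLw]; linarith [pow_nonneg hL0.le 20])
            ((hcont.mul hwtc).intervalIntegrable _ _)
            ((continuous_const.mul hwtc).intervalIntegrable _ _) fun v _ => ?_
          exact mul_le_mul_of_nonneg_right (hM v) (hwt0 v)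
      _ = M * ∫ v in (-Lw)..Lw, wt v := by rw [intervalIntegral.integral_const_mul]
      _ ≤ M * (2 * Real.sqrt π * ell D ^ 15) :=
          mul_le_mul_of_nonneg_left (integral_gaussWeight_le hL0 (by positivity)) hM0
  calc ∑ x ∈ T, E1main x w ^ 2 * g x
      ≤ (ell D ^ 68)⁻¹ ^ 2 * (2 * Real.sqrt π * ell D ^ 15) *
          ∫ v in (-Lw)..Lw, (∑ x ∈ T, ‖∑ n ∈ Finset.Ico 1 ⌈bigT D ^ 3⌉₊,
              x.ψ (n : ZMod x.p) * (n : ℂ) ^ (-(w + v * I))‖ ^ 2 * g x) * wt v := hred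
    _ ≤ (ell D ^ 68)⁻¹ ^ 2 * (2 * Real.sqrt π * ell D ^ 15) * (M * (2 * Real.sqrt π * ell D ^ 15)) :=
        mul_le_mul_of_nonneg_left hint (by positivity)
    _ = 4 * π * M * ell D ^ 30 / ell D ^ 136 := by
        set u : ℝ := Real.sqrt π with hu_def
        have hu : u ^ 2 = π := Real.sq_sqrt pi_pos.le
        rw [← hu, show (136 : ℕ) = 68 * 2 by norm_num, pow_mul]
        field_simp
        ring

/-! ## The edges I3-D → I3-E (two-point form, every exponent `kD`) -/

/-- **I3-E₁ from I3-D₁** (WP14-PLAN §3; scratch `meanSq_E1main_mul_B1_le`): if, for all large `D`,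
every finite `T`, and all `s, w` in the strip `|Re s − ½| ≤ 2α`, `|Re w − ½| ≤ 2α`,
`Σ_{ψ∈T}|D_{T³}(w,ψ)·(H₁₄+ι₂H₁₂)(s,ψ)|² ≤ C·P²·𝓛^{kD}` (item I3-D₁, stated inline verbatim), then on the
same strip `Σ_{ψ∈T} E₁(w,ψ)²·|(H₁₄+ι₂H₁₂)(s,ψ)|² ≤ C′·P²·𝓛^{kD+30}/𝓛¹³⁶` with `C′ = 4πC`
(`sum_E1main_sq_mul_le` at the weight `g(ψ) = |B₁(s,ψ)|²`, I3-D₁ at the points `w + iv` — still in the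
strip — and `∫ω₁ ≤ 2√π𝓛¹⁵` once more). [cite: Zhang2022LandauSiegel, §13 (13.11) p.75] -/
theorem meanSq_E1main_mul_B1_le_of (kD : ℕ)
    (hD : ∃ C : ℝ, 0 ≤ C ∧ ForAllLarge fun D _ χ =>
      ∀ (T : Finset (Chr D)) (s w : ℂ), |s.re - 1 / 2| ≤ 2 * alpha D → |w.re - 1 / 2| ≤ 2 * alpha D →
        ∑ x ∈ T, ‖(∑ n ∈ Finset.Ico 1 ⌈bigT D ^ 3⌉₊, x.ψ (n : ZMod x.p) * (n : ℂ) ^ (-w)) *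
            (H14 χ x s + iota2 * H12 χ x s)‖ ^ 2 ≤ C * bigP D ^ 2 * ell D ^ kD) :
    ∃ C : ℝ, 0 ≤ C ∧ ForAllLarge fun D _ χ =>
      ∀ (T : Finset (Chr D)) (s w : ℂ), |s.re - 1 / 2| ≤ 2 * alpha D → |w.re - 1 / 2| ≤ 2 * alpha D →
        ∑ x ∈ T, E1main x w ^ 2 * ‖H14 χ x s + iota2 * H12 χ x s‖ ^ 2 ≤
          C * bigP D ^ 2 * ell D ^ (kD + 30) / ell D ^ 136 := by
  obtain ⟨C, hC0, D₀, hC⟩ := hD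
  refine ⟨4 * π * C, by positivity, max D₀ ⌈Real.exp 3⌉₊, fun D _ χ hD hq hp T s w hs hw => ?_⟩
  have hD0 : D₀ ≤ D := le_trans (le_max_left _ _) hD
  have hL3 : 3 ≤ ell D := by
    have h1 : Real.exp 3 ≤ D := le_trans (Nat.le_ceil _) (by exact_mod_cast le_trans (le_max_right _ _) hD)
    have := Real.log_le_log (Real.exp_pos 3) h1
    rwa [Real.log_exp] at this
  have hL0 : 0 < ell D := by linarith
  set Lw : ℝ := ell D ^ 20 with hLw
  set wt : ℝ → ℝ := fun v => Real.exp (-(v ^ 2) / (4 * ell D ^ 30)) with hwt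
  set g : Chr D → ℝ := fun x => ‖H14 χ x s + iota2 * H12 χ x s‖ ^ 2 with hgdef
  have hg : ∀ x, 0 ≤ g x := fun x => sq_nonneg _
  have hred := sum_E1main_sq_mul_le T hL3 w g hg
  -- I3-D at the shifted points `w + iv`
  have hpt : ∀ v : ℝ, ∑ x ∈ T, ‖∑ n ∈ Finset.Ico 1 ⌈bigT D ^ 3⌉₊,
      x.ψ (n : ZMod x.p) * (n : ℂ) ^ (-(w + v * I))‖ ^ 2 * g x ≤ C * bigP D ^ 2 * ell D ^ kD := by
    intro v
    have hwv : |(w + v * I).re - 1 / 2| ≤ 2 * alpha D := by simpa using hw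
    have h := hC D χ hD0 hq hp T s (w + v * I) hs hwv
    refine le_of_eq_of_le ?_ h
    refine Finset.sum_congr rfl fun x _ => ?_
    rw [hgdef, ← mul_pow, ← norm_mul]
  -- integrate the constant bound against the Gaussian
  have hwtc : Continuous wt := by
    rw [hwt]; exact Real.continuous_exp.comp (by fun_prop)
  have hwt0 : ∀ v, 0 ≤ wt v := fun v => (Real.exp_pos _).le
  have hcont : Continuous fun v : ℝ => ∑ x ∈ T, ‖∑ n ∈ Finset.Ico 1 ⌈bigT D ^ 3⌉₊,
      x.ψ (n : ZMod x.p) * (n : ℂ) ^ (-(w + v * I))‖ ^ 2 * g x :=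
    continuous_finsetSum _ fun x _ => ((continuous_norm_dirPoly_shift x w _).pow 2).mul continuous_const
  have hint : ∫ v in (-Lw)..Lw, (∑ x ∈ T, ‖∑ n ∈ Finset.Ico 1 ⌈bigT D ^ 3⌉₊,
      x.ψ (n : ZMod x.p) * (n : ℂ) ^ (-(w + v * I))‖ ^ 2 * g x) * wt v ≤
      (C * bigP D ^ 2 * ell D ^ kD) * (2 * Real.sqrt π * ell D ^ 15) := by
    calc ∫ v in (-Lw)..Lw, (∑ x ∈ T, ‖∑ n ∈ Finset.Ico 1 ⌈bigT D ^ 3⌉₊,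
          x.ψ (n : ZMod x.p) * (n : ℂ) ^ (-(w + v * I))‖ ^ 2 * g x) * wt v
        ≤ ∫ v in (-Lw)..Lw, (C * bigP D ^ 2 * ell D ^ kD) * wt v := by
          refine intervalIntegral.integral_mono_on (by rw [hLw]; linarith [pow_nonneg hL0.le 20])
            ((hcont.mul hwtc).intervalIntegrable _ _)
            ((continuous_const.mul hwtc).intervalIntegrable _ _) fun v _ => ?_
          exact mul_le_mul_of_nonneg_right (hpt v) (hwt0 v)
      _ = (C * bigP D ^ 2 * ell D ^ kD) * ∫ v in (-Lw)..Lw, wt v := by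
          rw [intervalIntegral.integral_const_mul]
      _ ≤ (C * bigP D ^ 2 * ell D ^ kD) * (2 * Real.sqrt π * ell D ^ 15) :=
          mul_le_mul_of_nonneg_left (integral_gaussWeight_le hL0 (by positivity)) (by positivity)
  calc ∑ x ∈ T, E1main x w ^ 2 * ‖H14 χ x s + iota2 * H12 χ x s‖ ^ 2
      = ∑ x ∈ T, E1main x w ^ 2 * g x := rfl
    _ ≤ (ell D ^ 68)⁻¹ ^ 2 * (2 * Real.sqrt π * ell D ^ 15) *
          ∫ v in (-Lw)..Lw, (∑ x ∈ T, ‖∑ n ∈ Finset.Ico 1 ⌈bigT D ^ 3⌉₊,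
              x.ψ (n : ZMod x.p) * (n : ℂ) ^ (-(w + v * I))‖ ^ 2 * g x) * wt v := hred
    _ ≤ (ell D ^ 68)⁻¹ ^ 2 * (2 * Real.sqrt π * ell D ^ 15) *
          ((C * bigP D ^ 2 * ell D ^ kD) * (2 * Real.sqrt π * ell D ^ 15)) :=
        mul_le_mul_of_nonneg_left hint (by positivity)
    _ = 4 * π * C * bigP D ^ 2 * ell D ^ (kD + 30) / ell D ^ 136 := by
        set u : ℝ := Real.sqrt π with hu_def
        have hu : u ^ 2 = π := Real.sq_sqrt pi_pos.le
        rw [← hu, pow_add, show (136 : ℕ) = 68 * 2 by norm_num, pow_mul]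
        field_simp
        ring

/-- **I3-E₂ from I3-D₂** (scratch `meanSq_E1main_mul_B2_le`): the same with `B₂ = H₂` —
`Σ_{ψ∈T}|D_{T³}(w,ψ)H₂(s,ψ)|² ≤ C·P²·𝓛^{kD}` on the strip (item I3-D₂, inline) yields
`Σ_{ψ∈T} E₁(w,ψ)²|H₂(s,ψ)|² ≤ 4πC·P²·𝓛^{kD+30}/𝓛¹³⁶`. [cite: Zhang2022LandauSiegel, §13 (13.11) p.75] -/
theorem meanSq_E1main_mul_B2_le_of (kD : ℕ)
    (hD : ∃ C : ℝ, 0 ≤ C ∧ ForAllLarge fun D _ χ =>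
      ∀ (T : Finset (Chr D)) (s w : ℂ), |s.re - 1 / 2| ≤ 2 * alpha D → |w.re - 1 / 2| ≤ 2 * alpha D →
        ∑ x ∈ T, ‖(∑ n ∈ Finset.Ico 1 ⌈bigT D ^ 3⌉₊, x.ψ (n : ZMod x.p) * (n : ℂ) ^ (-w)) *
            H2 χ x s‖ ^ 2 ≤ C * bigP D ^ 2 * ell D ^ kD) :
    ∃ C : ℝ, 0 ≤ C ∧ ForAllLarge fun D _ χ =>
      ∀ (T : Finset (Chr D)) (s w : ℂ), |s.re - 1 / 2| ≤ 2 * alpha D → |w.re - 1 / 2| ≤ 2 * alpha D →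
        ∑ x ∈ T, E1main x w ^ 2 * ‖H2 χ x s‖ ^ 2 ≤
          C * bigP D ^ 2 * ell D ^ (kD + 30) / ell D ^ 136 := by
  obtain ⟨C, hC0, D₀, hC⟩ := hD
  refine ⟨4 * π * C, by positivity, max D₀ ⌈Real.exp 3⌉₊, fun D _ χ hD hq hp T s w hs hw => ?_⟩
  have hD0 : D₀ ≤ D := le_trans (le_max_left _ _) hD
  have hL3 : 3 ≤ ell D := by
    have h1 : Real.exp 3 ≤ D := le_trans (Nat.le_ceil _) (by exact_mod_cast le_trans (le_max_right _ _) hD)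
    have := Real.log_le_log (Real.exp_pos 3) h1
    rwa [Real.log_exp] at this
  have hL0 : 0 < ell D := by linarith
  set Lw : ℝ := ell D ^ 20 with hLw
  set wt : ℝ → ℝ := fun v => Real.exp (-(v ^ 2) / (4 * ell D ^ 30)) with hwt
  set g : Chr D → ℝ := fun x => ‖H2 χ x s‖ ^ 2 with hgdef
  have hg : ∀ x, 0 ≤ g x := fun x => sq_nonneg _
  have hred := sum_E1main_sq_mul_le T hL3 w g hg
  have hpt : ∀ v : ℝ, ∑ x ∈ T, ‖∑ n ∈ Finset.Ico 1 ⌈bigT D ^ 3⌉₊,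
      x.ψ (n : ZMod x.p) * (n : ℂ) ^ (-(w + v * I))‖ ^ 2 * g x ≤ C * bigP D ^ 2 * ell D ^ kD := by
    intro v
    have hwv : |(w + v * I).re - 1 / 2| ≤ 2 * alpha D := by simpa using hw
    have h := hC D χ hD0 hq hp T s (w + v * I) hs hwv
    refine le_of_eq_of_le ?_ h
    refine Finset.sum_congr rfl fun x _ => ?_
    rw [hgdef, ← mul_pow, ← norm_mul]
  have hwtc : Continuous wt := by
    rw [hwt]; exact Real.continuous_exp.comp (by fun_prop)
  have hwt0 : ∀ v, 0 ≤ wt v := fun v => (Real.exp_pos _).le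
  have hcont : Continuous fun v : ℝ => ∑ x ∈ T, ‖∑ n ∈ Finset.Ico 1 ⌈bigT D ^ 3⌉₊,
      x.ψ (n : ZMod x.p) * (n : ℂ) ^ (-(w + v * I))‖ ^ 2 * g x :=
    continuous_finsetSum _ fun x _ => ((continuous_norm_dirPoly_shift x w _).pow 2).mul continuous_const
  have hint : ∫ v in (-Lw)..Lw, (∑ x ∈ T, ‖∑ n ∈ Finset.Ico 1 ⌈bigT D ^ 3⌉₊,
      x.ψ (n : ZMod x.p) * (n : ℂ) ^ (-(w + v * I))‖ ^ 2 * g x) * wt v ≤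
      (C * bigP D ^ 2 * ell D ^ kD) * (2 * Real.sqrt π * ell D ^ 15) := by
    calc ∫ v in (-Lw)..Lw, (∑ x ∈ T, ‖∑ n ∈ Finset.Ico 1 ⌈bigT D ^ 3⌉₊,
          x.ψ (n : ZMod x.p) * (n : ℂ) ^ (-(w + v * I))‖ ^ 2 * g x) * wt v
        ≤ ∫ v in (-Lw)..Lw, (C * bigP D ^ 2 * ell D ^ kD) * wt v := by
          refine intervalIntegral.integral_mono_on (by rw [hLw]; linarith [pow_nonneg hL0.le 20])
            ((hcont.mul hwtc).intervalIntegrable _ _)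
            ((continuous_const.mul hwtc).intervalIntegrable _ _) fun v _ => ?_
          exact mul_le_mul_of_nonneg_right (hpt v) (hwt0 v)
      _ = (C * bigP D ^ 2 * ell D ^ kD) * ∫ v in (-Lw)..Lw, wt v := by
          rw [intervalIntegral.integral_const_mul]
      _ ≤ (C * bigP D ^ 2 * ell D ^ kD) * (2 * Real.sqrt π * ell D ^ 15) :=
          mul_le_mul_of_nonneg_left (integral_gaussWeight_le hL0 (by positivity)) (by positivity)
  calc ∑ x ∈ T, E1main x w ^ 2 * ‖H2 χ x s‖ ^ 2
      = ∑ x ∈ T, E1main x w ^ 2 * g x := rfl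
    _ ≤ (ell D ^ 68)⁻¹ ^ 2 * (2 * Real.sqrt π * ell D ^ 15) *
          ∫ v in (-Lw)..Lw, (∑ x ∈ T, ‖∑ n ∈ Finset.Ico 1 ⌈bigT D ^ 3⌉₊,
              x.ψ (n : ZMod x.p) * (n : ℂ) ^ (-(w + v * I))‖ ^ 2 * g x) * wt v := hred
    _ ≤ (ell D ^ 68)⁻¹ ^ 2 * (2 * Real.sqrt π * ell D ^ 15) *
          ((C * bigP D ^ 2 * ell D ^ kD) * (2 * Real.sqrt π * ell D ^ 15)) :=
        mul_le_mul_of_nonneg_left hint (by positivity)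
    _ = 4 * π * C * bigP D ^ 2 * ell D ^ (kD + 30) / ell D ^ 136 := by
        set u : ℝ := Real.sqrt π with hu_def
        have hu : u ^ 2 = π := Real.sq_sqrt pi_pos.le
        rw [← hu, pow_add, show (136 : ℕ) = 68 * 2 by norm_num, pow_mul]
        field_simp
        ring

end Literature.NumberTheory.LFunctions.Zhang2022.Typed.Section13
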